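import Summits.QuantumAdvantage.QuantumAdvantage.Theses.LinnikCubicClassGroups
import Summits.QuantumAdvantage.QuantumAdvantage.Theorems.LinnikCubicClassGroupsPureCubicClassGroupFBQPStubCubicLatticeFP
import Summits.QuantumAdvantage.QuantumAdvantage.Theorems.LinnikCubicClassGroupsPureCubicClassGroupFBQPStubPureCubicOrder
import Summits.QuantumAdvantage.QuantumAdvantage.Theorems.LinnikCubicClassGroupsPureCubicClassGroupFBQPStubCubicLogFP
import Summits.QuantumAdvantage.QuantumAdvantage.Theorems.LinnikCubicClassGroupsPureCubicClassGroupFBQPStubCubicOrderFP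
import Summits.QuantumAdvantage.QuantumAdvantage.Theorems.LinnikCubicClassGroupsPureCubicClassGroupFBQPStubCubicWalkOpsFP
import Summits.QuantumAdvantage.QuantumAdvantage.Theorems.LinnikCubicClassGroupsPureCubicClassGroupFBQPStubCubeRootsModP
import Summits.QuantumAdvantage.QuantumAdvantage.Theorems.LinnikCubicClassGroupsPureCubicClassGroupFBQPStubDegreeOnePrimeCodes
import Literature.NumberTheory.CubicFields.PureCubicInverseProgram
import Literature.NumberTheory.CubicFields.PureCubicLabelBounds
import Literature.NumberTheory.NumberFields.PureCubicEmbeddings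
import Literature.Computability.Cryptography.CubicClassSamplingSpecs

/-!
# Crux `LinnikCubicClassGroups.PureCubicClassGroupFBQP` (stmt-QuantumAdvantage-11544) — the class table of the stage, assembled

Line `arakelov-giant-step-cycle`, stub `stub_classStageAssembly` (S5b-ASM), helper `classStage_table`: from the cylinder-minimum
program (G2, `ClaimLexMin`), the table program (P5a, `ClaimTableFP`) and the table semantics (P5b, `ClaimTableSem`), ONE bundle
of walk programs `Fw` (concrete lattice arithmetic `PureCubicCodes.latProd/latScale`, the reduction step of `exists_cubic_redL`
— whose defining equations hold UNCONDITIONALLY, which gives the six-entry shape of its lattice outputs —, cube roots from coins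
P2, degree-one prime codes P3; the three principal-cycle programs are not used by the ladder table and are dummies) and ONE
order-code program `ordL` (G4) such that: the table is polynomial time in its argument tuple, and for EVERY admissible
`(a, b)` and EVERY cubic field `K ∋ θ`, `θ³ = ab²`, the structural interface `ClassTableInterfaceQ3 Fw a b K (ordL (a, b))`
holds (all program specifications are the landed G1/G3/G4/P2/P3/P4 facts; a real and a non-real embedding exist by
`PureCubicEmbeddings.exists_embeddings_pair`), and the order code is small (denominator `∣ 3`, six entries in `[0, den]`,
`PureCubicLabelBounds`).
-/

-- the problem namespace repeats the summit name (`QuantumAdvantage.QuantumAdvantage`)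
set_option linter.dupNamespace false

namespace Summit.QuantumAdvantage.QuantumAdvantage.Theorems.LinnikCubicClassGroups

open Literature.Computability.Complexity (CodeFP)
open Literature.Computability.Complexity.CodeFP (pairE strE natE intE bitE unE rawE)
open Literature.Computability.Cryptography (CubicClassTable.WalkFns)
open Literature.Computability.Cryptography.CubicClassTable (LexMinSpec LogSpec InvSpec ScaleSpec ProdSpec RedLEq PrimeSem
  RootsSem)
open Literature.Computability.Cryptography.CubicClassSampling (ClaimLexMin ClaimTableFP ClaimTableSem ClassTableInterfaceQ3
  TableArgs tableArgsE instOfArgs)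
open Literature.NumberTheory.CubicFields (PureCubicCodes.Mem PureCubicCodes.Canon PureCubicCodes.val)
open Literature.NumberTheory.CubicFields.PureCubicCodes (mulE normE latScale latProd latAddGen latOfGens codeOf
  den_dvd_of_mul_mem_order entries_le_den)
open Literature.NumberTheory.CubicFields.PureCubicWalkOps (exists_cubic_invE)
open Literature.NumberTheory.NumberFields.PureCubic (exists_embeddings_pair)
open scoped NumberField nonZeroDivisors

/-- The lattice product program returns six entries on EVERY input. -/
theorem length_latProd_snd (x : (ℕ × ℕ) × (ℕ × List ℤ) × (ℕ × List ℤ)) : (latProd x).2.length ≤ 6 :=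
  le_of_eq rfl

/-- The lattice scaling program returns six entries on EVERY input. -/
theorem length_latScale_snd (x : (ℕ × ℕ) × (ℕ × List ℤ) × (ℤ × ℤ × ℤ × ℕ)) : (latScale x).2.length ≤ 6 :=
  le_of_eq rfl

/-- **S5b-ASM `classStage_table`**: one bundle of walk programs and one order-code program for which the ladder class
table is polynomial time and has the structural interface `ClassTableInterfaceQ3` in every pure cubic field, with a
small order code. -/
theorem classStage_table :
    ClaimLexMin → ClaimTableFP → ClaimTableSem →
    ∃ (ordL : ℕ × ℕ → ℕ × List ℤ) (Fw : CubicClassTable.WalkFns),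
      CodeFP (pairE natE natE) (pairE natE (rawE intE)) ordL ∧
      CodeFP tableArgsE (pairE (pairE natE (rawE intE)) natE)
        (fun q : TableArgs => Fw.classTableOpQ (instOfArgs q) q.2.1 q.2.2) ∧
      ∀ (a b : ℕ), Squarefree (a * b) → a * b ≠ 1 →
        ∀ (K : Type) [Field K] [NumberField K], Module.finrank ℚ K = 3 →
          ∀ θ : K, θ ^ 3 = ((a * b ^ 2 : ℕ) : K) →
            ((ordL (a, b)).1 ≤ 3 ∧ (ordL (a, b)).2.length ≤ 6 ∧ ∀ h ∈ (ordL (a, b)).2, h.natAbs ≤ 3) ∧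
            ClassTableInterfaceQ3 Fw a b K (ordL (a, b)) := by
  intro hLex hFP hSem
  classical
  -- ### the programs
  obtain ⟨⟨hmulE, hnormE, hlatScale, hlatProd, hlatAddGen⟩, hG1⟩ := stub_cubicLatticeFPCore
  obtain ⟨lexE, hlexE, hLexSpec⟩ := hLex
  obtain ⟨logE, hlogE, hLog⟩ := stub_cubicLogFP
  obtain ⟨ordL, hordL, hOrd⟩ := stub_cubicOrderFPCore mulE normE latAddGen hmulE hnormE hlatAddGen
  obtain ⟨invE, hinvE, hInv⟩ := exists_cubic_invE
  obtain ⟨redL, hredL, hRed⟩ := exists_cubic_redL latScale lexE logE invE hlatScale hlexE hlogE hinvE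
  obtain ⟨roots, hroots, hRoots⟩ := stub_cubeRootsModP
  obtain ⟨primeL, hprimeL, hPrime⟩ := stub_degreeOnePrimeCodes
  set Fw : CubicClassTable.WalkFns := ⟨roots, primeL, latProd, redL, fun _ => ((0, []), 0), fun _ => ((0, []), 0),
    fun _ => ((0, []), 0)⟩ with hFw
  have h6red : ∀ x, ((Fw.redL x).1).2.length ≤ 6 := by
    rintro ⟨⟨⟨a, b⟩, prec⟩, c⟩
    show ((redL (((a, b), prec), c)).1).2.length ≤ 6
    rw [(hRed a b prec c).1]
    exact length_latScale_snd _
  refine ⟨ordL, Fw, hordL, hFP.1 Fw hroots hprimeL hlatProd hredL length_latProd_snd h6red, ?_⟩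
  -- ### an admissible instance and field
  intro a b hsq hab1 K _ _ hdeg θ hθ
  have ha0 : a ≠ 0 := fun h => by rw [h, zero_mul] at hsq; exact not_squarefree_zero hsq
  have hb0 : b ≠ 0 := fun h => by rw [h, mul_zero] at hsq; exact not_squarefree_zero hsq
  have ha1 : 1 ≤ a := Nat.one_le_iff_ne_zero.mpr ha0
  have hb1 : 1 ≤ b := Nat.one_le_iff_ne_zero.mpr hb0
  have hbK : (b : K) ≠ 0 := Nat.cast_ne_zero.mpr hb0
  -- the facts of the pure cubic order (B)
  obtain ⟨hθi, hθ₂i, h3O, hind, hnorm, htr⟩ := stub_pureCubicOrder a b hsq hab1 K hdeg θ hθ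
  have h3O' : ∀ ξ : K, IsIntegral ℤ ξ → ∃ c₀ c₁ c₂ : ℤ, (3 : K) * ξ = c₀ + c₁ * θ + c₂ * (θ ^ 2 / (b : K)) :=
    fun ξ hξ => h3O ⟨ξ, hξ⟩
  -- the specifications of the lattice programs at `(a, b, K, θ)` (G1)
  obtain ⟨hmulK, hnormK, -, hscaleK, hprodK, haddK⟩ := hG1 a b K θ hbK hθ hind hnorm
  -- the order code (G4)
  obtain ⟨hcanon, hmem⟩ := hOrd a b K hdeg θ hθi hθ₂i h3O' htr hmulK hnormK haddK
  -- the embeddings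
  obtain ⟨σ₁, σ₂, hσ₂⟩ := exists_embeddings_pair hdeg hsq hab1 hθ
  refine ⟨?_, ?_⟩
  · -- ### the order code is small: den ∣ 3, six entries in [0, den]
    have hden : (ordL (a, b)).1 ∣ 3 :=
      den_dvd_of_mul_mem_order θ b hind hcanon (N := 3) (by norm_num) fun φ hφ => by
        obtain ⟨c₀, c₁, c₂, e⟩ := h3O' φ ((hmem φ).mp hφ)
        exact ⟨c₀, c₁, c₂, by exact_mod_cast e⟩
    have hden3 : (ordL (a, b)).1 ≤ 3 := Nat.le_of_dvd (by norm_num) hden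
    have hent := entries_le_den θ b hind hcanon ((hmem 1).mpr isIntegral_one) ((hmem θ).mpr hθi)
      ((hmem _).mpr hθ₂i)
    refine ⟨hden3, ?_, fun h hh => ?_⟩
    · obtain ⟨h11, h12, h13, h22, h23, h33, hc2, -⟩ := hcanon
      rw [hc2]; simp
    · obtain ⟨h0, hle⟩ := hent h hh
      have : h.natAbs = h := Int.natAbs_of_nonneg h0
      omega
  · -- ### the structural interface from the semantics part (P5b)
    refine hSem Fw lexE logE invE latScale a b hsq hab1 K hdeg θ hθ σ₁ σ₂ hσ₂ (ordL (a, b)) hcanon hmem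
      (hLexSpec a b hsq hab1 K hdeg θ hθ σ₁ σ₂ hσ₂) (fun e prec hden hV => hLog a b ha1 hb1 e prec hden hV)
      (fun e hden hval => hInv a b K θ hbK hθ hnorm e hden hval) hscaleK
      (fun prec c _ _ => hRed a b prec c) hprodK ?_ ?_
    · -- degree-one prime codes (P3)
      intro p hp hpab
      obtain ⟨h1, h2, h3⟩ := hPrime a b hsq hab1 K hdeg θ hθ (ordL (a, b)) hcanon hmem p hp hpab
      refine ⟨fun r hr hr3 => ?_, h2, h3⟩
      obtain ⟨hc, P, hP, hPp, hN, hM⟩ := h1 r hr hr3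
      exact ⟨hc, P, hP, hPp, hN, hM⟩
    · -- cube roots from coins (P2)
      exact fun p m' hp hpm s' ℓ hℓ => hRoots p m' hp hpm s' ℓ hℓ

end Summit.QuantumAdvantage.QuantumAdvantage.Theorems.LinnikCubicClassGroups
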